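import Literature.MathematicalPhysics.QuantumFieldTheory.Balaban1983to89.B9Eq3105FamThreeTFar

/-!
# `Balaban1983to89.B9Eq3105FamThreeTCover` — THE TRANSPOSED (`hV′`) FAMILY 3 OF (3.105), `Σ_□ h_□O_□h_□·ζ_□̃(DPD* − DP_□D*)`, SUMMED OVER THE COVER FROM THE
# PER-CUBE LOCATED DIFFERENCE WITH GLOBAL SOURCES `h_□·(DPD* − Pl_□)`: the `O_□` factor in front ([4] (2.52)'s y″-sum with the transfer of `ℓ⁻²`), the row
# indicator from the leading `h_□`, the finite overlap `Σ_□ 𝟙[a ∈ S_□] ≤ 3·5^{d+1}` read AT THE ROW, and the `ℓ(a)ℓ(a′)⁻¹` currency of `hV′`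
# (sub-row G-B9-LETTERS, GAPS G-B9-05∕family 3, programme FAMTHREE FILE F3-D2; lead g34 RULINGS FAMTHREE ∕ FAMTHREE-2; division p38 g47 ∕ p33 g103 2026-08-29)

statement-level skeleton of published theorems with citation tags; proofs where landed; nothing here is a claim about the Yang–Mills mass gap

THE PRINTED LOCUS (verbatim, held `paper:balaban1985-cmp99-background-propagators`, journal page = PDF page + 388).  p. 414 (3.105), third sum: «− Σ_□ ζ_□̃(DPD* −
DP_□D*)h_□G_□h_□»; (3.106) p. 414 «G = G₀(I − R)⁻¹ = Σ_{n=0}^∞ G₀Rⁿ.» (the tree's `hV′` is M5.7's device: the expansion multiplied from the right, remainder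
read from `|·|₍₋₁₎` to `|·|₍₋₃₎` — not a printed sentence); p. 415 l. 18–37 («The expansion of the term in the third sum gives also small terms, except the
following one … This expression cancels the second term in the third sum.»); p. 415 l. 34–35 («Using the fact that ζ_□̃h_□ = h_□»); p. 412 l. 22–36 (the
[2]-difference paragraph: «can be estimated by the usual factors multiplied by e^{−2δ₀M}»); (3.87) p. 409 («G₀ = Σ_□ h_□G_□h_□»); (3.91) p. 410; p. 398 (remark
after (3.47), the scale-transfer device of [4] (2.60)); [4] (2.51)–(2.55) p. 232, (2.36) p. 229, p. 235, Lemma 2.1 (2.60)–(2.61) p. 234, (2.46) p. 231.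

WHY THIS FILE.  M5.7's consumer `B9Thm310DeltaAIsUnitOfExpansion.eBlock_kernelFamilyBInv_GAY_of_localInverseCubes''` displays the transposed family 3 in `hV′` as
`Σ_□ conj b((M_{h_□}·O_□(cfg U₁)·M_{h_□}·(M_{ζ_□}·(DPDsY parS G′ (cfg U₁) − Pl □)))^ℝ)` inside a sum bounded by `θV′·ℓ(a)·ℓ(a′)⁻¹·e^{−δ₀d(a,a′)}` over the member's bond
carrier `(toB6 (geo9K i) Rr Hp, ιB∘blkV1)`.  THIS FILE is the letter-free cover bookkeeping, the twin of p33's F3-C `B9Eq3105FamThreeCover` for the `hrest` word: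
from ONE per-cube binder `hXT □ : conj b((M_{h_□}·(P − Pl □))^ℝ) ≺ K_T·ℓ(a)⁻²·e^{−a_Tδ₀d}` (the located difference WITH GLOBAL SOURCES — supplied by F3-D1
`B9Eq3105FamThreeTFar.hasMajorant_famThreeT_located` from F3-B's both-sides-located word at the swapped pair plus the separation pieces) and the (3.42) blocks of the
cut letters `O_□` it assembles the `hV′` summand: `M_ζ` drops (F3-A `famThreeT_word_eq`, «ζ_□̃h_□ = h_□»), the word is `mulOp h♭·(conj b(O^ℝ)·conj b((M_h·(P − Pl))^ℝ))`,
[4] (2.52)'s y″-sum pairs `O`'s `ℓ(a)²` with the difference's `ℓ(y″)⁻²` by the transfer of `ℓ⁻²` (p21 `B9Eq395Small.conv_majorant`), the leading `h_□` puts the ROW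
indicator `𝟙[a ∈ S_□]` (r05∕p21 `hasMajorant_mulOp_rows`), the cover multiplicity is read at the row (`hasMajorant_localSum`, `hcnt_SQT`), and p33's `flat_le_src_weight`
converts the flat kernel into the `ℓ(a)ℓ(a′)⁻¹` currency.  So the state of the transposed family 3 is read off ONE binder: `hXT`.

WHAT THIS FILE CERTIFIES (kernel-checked; 0 `def`, 0 `def … : Prop`, 0 sorry; standard axioms only)

* §0 `scaleTransfer_len_sq_inv_geo9K` — [4] (2.60) for the weight `(Lʲη)⁻²` on the member (`transferL_geo9K` at `q = −2`): the displayed transfer's supplier above a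
  member threshold `2·log L ≤ αδ(2L²−1)M`.
* §1 `conj_famThreeT_eq` — the `hV′` word in real coordinates after `ζ_□̃h_□ = h_□`: `conj b((M_h·O·M_h·(M_ζ·(P − Pl)))^ℝ) = mulOp h♭·(conj b(O^ℝ)·conj b((M_h·(P − Pl))^ℝ))`.
* §2 ★★ `hasMajorant_famThreeT_core` — PER CUBE, for ANY `ζ` with `ζ = 1` on `supp h_□`, ANY bond operators `O, P, Pl`: from `hXT` (`K_T·ℓ(a)⁻²·e^{−a_Tδ₀d}`),
  `hO` (`B_O·ℓ(y)²·e^{−b_Oδ₀d}`), the transfer of `ℓ⁻²` at `α_st`, (2.61) at `a_T − ρ`, `α_st + ρ ≤ b_O`: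
  `conj b((M_{h_□}·O·M_{h_□}·(M_ζ·(P − Pl)))^ℝ) ≺ 𝟙[a ∈ S_□]·(B_OK_TΛc₁(δ₀, a_T − ρ))·e^{−ρδ₀d(a,b′)}`.
* §3 ★★★ `hasMajorant_sum_famThreeT` (the cover sum, FLAT: `≺ 3·5^{d+1}·(B_OK_TΛc₁)·e^{−ρδ₀d}`), ★★★ `hasMajorant_sum_famThreeT_of_eBlock` (the consumer's letters: `hO` READ OFF
  `hEO : ∀ □, EBlock (kernelFamilyBInv i B cfg (Oc □) par) B₀ δ U₁`, `B_O = M₂Σ‖b_j‖B₀`, `b_O = 1`), ★★ `hasMajorant_sum_famThreeT_zetaY_of_eBlock` (ζ of record `zetaY`,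
  `P := DPDsY i parS G′ (cfg U₁)` — the consumer's `hV′` family-3 summand VERBATIM, flat kernel).
* §4 ★★ `hasMajorant_src_of_flat` ∕ `hasMajorant_sum_famThreeT_zetaY_of_eBlock_src` — the same in `hV′`'s currency `Θ·ℓ(a)·ℓ(a′)⁻¹·e^{−(1−α_m)ρδ₀d}` under the
  transfer of `ℓ` at `α_m` (p33 D3 `flat_le_src_weight`; supplier D4 `scaleTransfer_len_geo9K` above a threshold).
* §5 ★★★ `hasMajorant_sum_famThreeT_zetaY_of_near` — ONE theorem for the assembler: F3-D1 §4 (`hasMajorant_famThreeT_located`) inside §4's cover theorem, so the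
  `hV′` family-3 summand (with `Pl □ := locProjBY □ parS (u □) Ṽ_□`) is read off the NEAR binders `hXn □` (F3-B at the swapped pair) + `hP` + the cube data `hPlC □` + `hEO` + geometry.
* §6 ★★★ `hasMajorant_sum_famThreeT_zetaY_of_near_closedP` — §5 with `hP` SUPPLIED by p33's Z2-P §2 `hasMajorant_conj_DPDsY_of_eBlockInv` (inputs: `hE`, `hCinv`, bi-contractive
  `parS`, `η = |c_f|⁻¹`, the member (2.61) ∕ transfers of `ℓ, ℓ², ℓ⁻⁴`), exactly as Z2-P §3 closed family 2.

HONEST SCOPE ∕ NOT CLAIMED.  (i) `hXT □` is DISPLAYED here; its supplier F3-D1 is itself modulo the near binder `hXn` = p33's F3-B Member §5 at the swapped pair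
`(hTY i □, zetaY i □)`, which is modulo the located `G′`-difference entries D1 (supplier NONE, GAPS G-B9-05; [B9] p. 412 l. 22–36, p. 399 l. 19–24, [2] (1.11)–(1.12))
and the `C`-difference word `hT3` (F3-B3) — nothing of that analysis is asserted in this file.  (ii) `hEO`, the member (2.61), the transfers of `ℓ⁻²` and `ℓ` are
DISPLAYED (suppliers: the consumer's `hE`, `B9GeoInputsMultiRateKLevelV1`, §0, `scaleTransfer_len_geo9K` above thresholds).  (iii) NOT here: the `hrest` word (F3-C),
families 2 and 4 (Z2-P `hasMajorant_sum_famTwoT_zetaY` — the transposed family 2 VANISHES at the ζ of record —, FAMFOUR α-3), the knit into `hV′`, the smallness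
`hsmallV`.  Count-neutral; NOT a node discharge; no summit ∕ sub-problem statement is proved; nothing continuum ∕ OS ∕ mass-gap ∕ Clay; YM mass gap NOT proved (Track A
conditional rung).  No `sorry`, no `axiom`, no `… : Prop` fact, no `instance`, no `notation`, no `def`.  NEW file; nothing landed is modified.  Cell `lit-balaban`,
seat `lit-balaban-p38` gen 47, 2026-08-29; `--supports stmt-QuantumFields-19200` as helper.  Net new unproved facts: 0.

RELATED IN THE TREE, NOT DUPLICATED (searched 2026-08-29: `rg 'famThreeT' Literature/` = F3-A `famThreeT_word_eq` + F3-D1): p33 F3-C `B9Eq3105FamThreeCover` (the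
`hrest` twin — pattern), Z2-core∕Z2-cover (`geo9K_axioms`, `mem_SQT_of_hBdY_hTY_ne_zero`), p21 `B9Eq395Small.conv_majorant`, r05∕p21 `B9Thm39CinvSepMiddle.hasMajorant_mulOp_rows`,
r03 `B9Thm37Sum.hasMajorant_localSum`, p21∕p38 `B9Thm37GpTorusRegularCubes.hcnt_SQT`, `B9CubeLettersInvReadDictBMajorants.hasMajorant_conj_G_of_eBlockInvB`, p33
`B9Eq3105ZetaY` (`zetaY_eq_one_of_hTY_ne_zero`), D3 `B9Cor36GCubeLocDefectCover.flat_le_src_weight`, r05 `B9GeoLemma21KLevelV1.transferL_geo9K` — all USED BY NAME.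
-/

noncomputable section

namespace Literature.MathematicalPhysics.QuantumFieldTheory.Balaban1983to89.B9Eq3105FamThreeTCover

open NormedSpace Complex
open B6RandomWalk (HasMajorant hasMajorant_mono Ineq261 c1_nonneg Triangle254)
open B9FromB6 (EBlock)
open B9Thm34Ext (toB6)
open B9Thm37Sum (mulOp mulOp_apply hasMajorant_localSum)
open B9Ineq347 (ScaleTransfer)
open B9Eq352DivFormLetters (conj)
open B6KLevelCensusIndexV1 (KIdx)
open B6Cover236MultiLevelBlocks (cubes)
open B6GlobalChartV1 (blkV1)
open B6Ineq2142KLevelV1 (β)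
open B9GeoNormsKLevelV1 (geo9K)
open B9GeoLemma21KLevelV1 (transferL_geo9K geo9K_len_pos geo9K_one_le_L)
open B9Thm37CubeCoverCommutators (cutMulY cutMulY_apply hTY)
open B9Thm37GpTorusRegularCubes (SQT hcnt_SQT)
open B9Thm39CinvTorusRegular (conj_cutMulY)
open B9Thm39CinvSepMiddle (hasMajorant_mulOp_rows)
open B9Eq395Small (conv_majorant)
open B9Eq3104CutoffCommutators (hBdY hBdY_apply DPDsY)
open B9Eq3105ZetaY (zetaY zetaY_eq_one_of_hTY_ne_zero)
open B9Eq3105FamTwoCore (geo9K_axioms mem_SQT_of_hBdY_hTY_ne_zero)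
open B9Eq3105FamThreeLetters (famThreeT_word_eq)
open B9CubeLettersInvReadings (kernelFamilyBInv)
open B9CubeLettersInvReadDictBMajorants (hasMajorant_conj_G_of_eBlockInvB)
open B9Cor36GCubeLocDefectCover (flat_le_src_weight)
open Node00 (SiteY BlkY IBondY FBondY CfgY SiteOpY BondOpY SiteParY BondParY toKT)

variable {d ℓ : ℕ} {hd : 1 ≤ d + 1} {hL : Odd (ℓ + 1) ∧ 1 < ℓ + 1} {b₀ b₁ : ℝ}
variable {𝔸 : Type} [NormedRing 𝔸] [NormedAlgebra ℂ 𝔸] [CompleteSpace 𝔸]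
variable {ι : Type} [Fintype ι]
variable (i : KIdx d ℓ hd hL b₀ b₁) (c : ↥(cubes i.D.toDomains)) (b : Module.Basis ι ℝ 𝔸)

/-! ## §0  [4] (2.60) for the weight `(Lʲη)⁻²` on the member -/

/-- ★ **SCALE TRANSFER FOR THE WEIGHT `(Lʲη)⁻²`** (the (3.49)₄ weight of the located difference): under the size condition `2·log L ≦ αδ(2L²−1)M` (`αδ > 0`),
`e^{−αδd(y,y′)}(L^{j′}η)⁻² ≦ L²(Lʲη)⁻²` for all `y, y′` (`transferL_geo9K` at `q = −2`). [cite: Balaban1985BackgroundPropagators, p.398 remark after (3.47), (3.49) p.399; Balaban1984PropagatorsII, Lemma 2.1 (2.60) p.234] -/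
theorem scaleTransfer_len_sq_inv_geo9K {δ α : ℝ} (hε : 0 < α * δ)
    (hM : 2 * Real.log ((ℓ : ℝ) + 1) ≤ α * δ * (2 * ((ℓ : ℝ) + 1) ^ 2 - 1) * (geo9K i).M) :
    ScaleTransfer (geo9K i) δ α (((ℓ : ℝ) + 1) ^ 2) (fun a => ((geo9K i).len a ^ 2)⁻¹) := by
  have geo9K_L_eq : (geo9K i).L = (ℓ : ℝ) + 1 := by
    show (((ℓ + 1 : ℕ) : ℝ)) = (ℓ : ℝ) + 1
    push_cast; ring
  have h2 : |(-2 : ℝ)| = 2 := by norm_num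
  have hq : |(-2 : ℝ)| * Real.log (geo9K i).L ≤ α * δ * (2 * ((ℓ : ℝ) + 1) ^ 2 - 1) * (geo9K i).M := by
    rw [h2, geo9K_L_eq]; exact hM
  have hT := transferL_geo9K i hε (-2 : ℝ) hq
  have hC : (geo9K i).L ^ |(-2 : ℝ)| = ((ℓ : ℝ) + 1) ^ 2 := by
    rw [h2, geo9K_L_eq, show (2 : ℝ) = ((2 : ℕ) : ℝ) by norm_num, Real.rpow_natCast]
  have e : ∀ y : (geo9K i).Site, (geo9K i).len y ^ (-2 : ℝ) = ((geo9K i).len y ^ 2)⁻¹ := fun y => by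
    rw [Real.rpow_neg (geo9K_len_pos i y).le, show (2 : ℝ) = ((2 : ℕ) : ℝ) by norm_num, Real.rpow_natCast]
  intro y y'
  have h := hT y y'
  rw [e, e, hC] at h
  have hE : 0 < Real.exp (α * δ * (geo9K i).dist y y') := Real.exp_pos _
  rw [Real.exp_neg, inv_mul_le_iff₀ hE]
  calc ((geo9K i).len y' ^ 2)⁻¹ ≤ ((ℓ : ℝ) + 1) ^ 2 * Real.exp (α * δ * (geo9K i).dist y y') * ((geo9K i).len y ^ 2)⁻¹ := h
    _ = Real.exp (α * δ * (geo9K i).dist y y') * (((ℓ : ℝ) + 1) ^ 2 * ((geo9K i).len y ^ 2)⁻¹) := by ring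

/-! ## §1  The transposed family-3 word in real coordinates -/

omit [CompleteSpace 𝔸] in
/-- ★ `conj b((M_{h_□}·O·M_{h_□}·(M_ζ·(P − Pl)))^ℝ) = mulOp h♭·(conj b(O^ℝ)·conj b((M_{h_□}·(P − Pl))^ℝ))` when `ζ = 1` on `supp h_□` — F3-A's `ζ_□̃h_□ = h_□`, then the leading
cut-off, the cut letter, the located difference. [cite: Balaban1985BackgroundPropagators, (3.105)–(3.106) p.414, p.415 («ζ_□̃h_□ = h_□»), (3.87) p.409; Balaban1984PropagatorsII, (2.52)–(2.55) p.232] -/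
theorem conj_famThreeT_eq (ζ : SiteY i → ℝ) (hζ : ∀ z, hTY i c z ≠ 0 → ζ z = 1) (O P Pl : (FBondY i → 𝔸) →ₗ[ℂ] (FBondY i → 𝔸)) :
    conj b ((cutMulY (𝔸 := 𝔸) (hBdY i (hTY i c)) * O * cutMulY (𝔸 := 𝔸) (hBdY i (hTY i c)) *
        (cutMulY (𝔸 := 𝔸) (hBdY i ζ) * (P - Pl))).restrictScalars ℝ) =
      mulOp (fun p : FBondY i × ι => hBdY i (hTY i c) p.1) *
        (conj b (O.restrictScalars ℝ) * conj b ((cutMulY (𝔸 := 𝔸) (hBdY i (hTY i c)) * (P - Pl)).restrictScalars ℝ)) := by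
  rw [famThreeT_word_eq i c ζ hζ O P Pl]
  have hsplit : ((cutMulY (𝔸 := 𝔸) (hBdY i (hTY i c)) * O * cutMulY (𝔸 := 𝔸) (hBdY i (hTY i c)) * (P - Pl)).restrictScalars ℝ :
      Module.End ℝ (FBondY i → 𝔸)) =
      (cutMulY (𝔸 := 𝔸) (hBdY i (hTY i c))).restrictScalars ℝ *
        (O.restrictScalars ℝ * (cutMulY (𝔸 := 𝔸) (hBdY i (hTY i c)) * (P - Pl)).restrictScalars ℝ) :=
    LinearMap.ext fun _ => rfl
  rw [hsplit, B9Eq352DivFormLetters.conj_mul, B9Eq352DivFormLetters.conj_mul, conj_cutMulY]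

/-! ## §2  The per-cube estimate from the located difference with global sources -/

omit [CompleteSpace 𝔸] in
open Classical in
set_option maxHeartbeats 1600000 in
/-- ★★ **THE TRANSPOSED FAMILY 3 OF (3.105) PER CUBE ON THE MEMBER's BOND CARRIER, FROM THE LOCATED DIFFERENCE WITH GLOBAL SOURCES.**  Let `ζ` be ANY site profile with
`ζ = 1` on `supp h_□`, `O, P, Pl` any bond operators with `conj b((M_{h_□}·(P − Pl))^ℝ) ≺ K_T·ℓ(a)⁻²·e^{−a_Tδ₀d}` (the located difference, sources global — F3-D1) and
`conj b(O^ℝ) ≺ B_O·ℓ(y)²·e^{−b_Oδ₀d}` ((3.42)₀ shape), the scale transfer of `ℓ⁻²` at `α_st`, (2.61) at `a_T − ρ`, `α_st + ρ ≤ b_O`.  Then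
`conj b((M_{h_□}·O·M_{h_□}·(M_ζ·(P − Pl)))^ℝ) ≺ 𝟙[a ∈ S_□]·(B_OK_TΛc₁(δ₀, a_T − ρ))·e^{−ρδ₀d(a,b′)}` — [4] (2.52)'s y″-sum (`conv_majorant` with the weight `P(a) = ℓ(a)⁻²`:
`O`'s `ℓ(a)²` against the difference's `ℓ(y″)⁻²`), then the leading `M_{h_□}` localizes the ROW in `S_□` (`hasMajorant_mulOp_rows`).
[cite: Balaban1985BackgroundPropagators, (3.105)–(3.106) p.414, p.415 l.18–37, p.412 l.22–36, (3.49) p.399, (3.87) p.409, p.398 (remark after (3.47)); Balaban1984PropagatorsII, (2.52)–(2.55) p.232, p.235, Lemma 2.1 (2.60)–(2.61) p.234] -/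
theorem hasMajorant_famThreeT_core (ζ : SiteY i → ℝ) (hζ : ∀ z, hTY i c z ≠ 0 → ζ z = 1)
    [Fintype (geo9K i).Site] (ιB : BlkY i → IBondY i) (hι : ∀ s, β i.hN i.D i.hk (ιB s) = s) (Rr : ℝ) (Hp : Prop)
    (O P Pl : (FBondY i → 𝔸) →ₗ[ℂ] (FBondY i → 𝔸)) (dB : ℕ) {δ₀ aT bO αst ρ KT BO Λ : ℝ}
    (hδ₀ : 0 ≤ δ₀) (hKT : 0 ≤ KT) (hBO : 0 ≤ BO) (hΛ : 0 ≤ Λ) (hρ : 0 ≤ ρ) (hsplit : αst + ρ ≤ bO)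
    (h261 : Ineq261 dB (toB6 (geo9K i) Rr Hp) δ₀ (aT - ρ)) (hST : ScaleTransfer (geo9K i) δ₀ αst Λ (fun a => ((geo9K i).len a ^ 2)⁻¹))
    (hXT : HasMajorant (g := toB6 (geo9K i) Rr Hp) (fun p : FBondY i × ι => ιB (blkV1 i.hN i.D p.1))
      (conj b ((cutMulY (𝔸 := 𝔸) (hBdY i (hTY i c)) * (P - Pl)).restrictScalars ℝ))
      (fun a y => KT * ((geo9K i).len a ^ 2)⁻¹ * Real.exp (-(aT * δ₀ * (geo9K i).dist a y))))
    (hO : HasMajorant (g := toB6 (geo9K i) Rr Hp) (fun p : FBondY i × ι => ιB (blkV1 i.hN i.D p.1)) (conj b (O.restrictScalars ℝ))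
      (fun y b' => BO * (geo9K i).len y ^ 2 * Real.exp (-(bO * δ₀ * (geo9K i).dist y b')))) :
    HasMajorant (g := toB6 (geo9K i) Rr Hp) (fun p : FBondY i × ι => ιB (blkV1 i.hN i.D p.1))
      (conj b ((cutMulY (𝔸 := 𝔸) (hBdY i (hTY i c)) * O * cutMulY (𝔸 := 𝔸) (hBdY i (hTY i c)) *
        (cutMulY (𝔸 := 𝔸) (hBdY i ζ) * (P - Pl))).restrictScalars ℝ))
      (fun a b' => (if a ∈ SQT i c then (1 : ℝ) else 0) *
        ((BO * KT * Λ * B6.c1 dB δ₀ (aT - ρ)) * Real.exp (-(ρ * δ₀ * (geo9K i).dist a b')))) := by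
  obtain ⟨htri, hsymm, hdnn⟩ := geo9K_axioms i Rr Hp
  have hℓ2i : ∀ a : (geo9K i).Site, 0 < ((geo9K i).len a ^ 2)⁻¹ := fun a => inv_pos.2 (pow_pos (B6KLevelCensusIndexV1.len_pos i a) 2)
  set blk : FBondY i × ι → (geo9K i).Site := fun p => ιB (blkV1 i.hN i.D p.1) with hblk
  -- `O`'s weight `ℓ(a)² = (ℓ(a)⁻²)⁻¹`
  have hA : HasMajorant (g := toB6 (geo9K i) Rr Hp) blk (conj b (O.restrictScalars ℝ))
      (fun a y'' => BO * (((geo9K i).len a ^ 2)⁻¹)⁻¹ * Real.exp (-(bO * δ₀ * (geo9K i).dist a y''))) :=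
    hasMajorant_mono (g := toB6 (geo9K i) Rr Hp) _ hO fun a y'' => le_of_eq (by rw [inv_inv])
  -- the located difference, source indicator trivial
  have hT : HasMajorant (g := toB6 (geo9K i) Rr Hp) blk (conj b ((cutMulY (𝔸 := 𝔸) (hBdY i (hTY i c)) * (P - Pl)).restrictScalars ℝ))
      (fun (y'' b' : (geo9K i).Site) => (if b' ∈ (Finset.univ : Finset (geo9K i).Site) then (1 : ℝ) else 0) *
        (KT * ((geo9K i).len y'' ^ 2)⁻¹ * Real.exp (-(aT * δ₀ * (geo9K i).dist y'' b')))) := by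
    refine hasMajorant_mono (g := toB6 (geo9K i) Rr Hp) _ hXT fun (y'' b' : (geo9K i).Site) => le_of_eq ?_
    show KT * ((geo9K i).len y'' ^ 2)⁻¹ * Real.exp (-(aT * δ₀ * (geo9K i).dist y'' b')) =
      (if b' ∈ (Finset.univ : Finset (geo9K i).Site) then (1 : ℝ) else 0) *
        (KT * ((geo9K i).len y'' ^ 2)⁻¹ * Real.exp (-(aT * δ₀ * (geo9K i).dist y'' b')))
    rw [if_pos (Finset.mem_univ b'), one_mul]
  have hAT := conv_majorant (R := Rr) (H := Hp) blk dB δ₀ bO αst ρ aT BO KT Λ (fun a => ((geo9K i).len a ^ 2)⁻¹) Finset.univ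
    hBO hKT hΛ hℓ2i hδ₀ hρ hsplit htri hsymm hdnn hST h261 hA hT
  -- the leading cut-off: row indicator
  have hh1 : ∀ p : FBondY i × ι, |hBdY i (hTY i c) p.1| ≤ 1 := fun p =>
    B6Partition118KLevelTorus.abs_hT_le_one i.D (B9GeoLemma21KLevelV1.one_le_Mh i) (B9GeoLemma21KLevelV1.one_le_P i) c _
  have hrow := hasMajorant_mulOp_rows (R := Rr) (H := Hp) blk hAT (fun p : FBondY i × ι => hBdY i (hTY i c) p.1) hh1 (SQT i c)
    fun p hp => by by_contra hne; exact hp (mem_SQT_of_hBdY_hTY_ne_zero i c ιB hι hne)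
  rw [conj_famThreeT_eq i c b ζ hζ O P Pl]
  refine hasMajorant_mono (g := toB6 (geo9K i) Rr Hp) _ hrow fun (a b' : (geo9K i).Site) => le_of_eq ?_
  show (if a ∈ SQT i c then (1 : ℝ) else 0) *
        ((if b' ∈ (Finset.univ : Finset (geo9K i).Site) then (1 : ℝ) else 0) * (BO * KT * Λ * B6.c1 dB δ₀ (aT - ρ)) *
          Real.exp (-(ρ * δ₀ * (geo9K i).dist a b'))) =
      (if a ∈ SQT i c then (1 : ℝ) else 0) * ((BO * KT * Λ * B6.c1 dB δ₀ (aT - ρ)) * Real.exp (-(ρ * δ₀ * (geo9K i).dist a b')))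
  rw [if_pos (Finset.mem_univ b'), one_mul]

/-! ## §3  The cover sum (flat kernel) -/

omit [CompleteSpace 𝔸] in
open Classical in
set_option maxHeartbeats 1600000 in
/-- ★★★ **THE TRANSPOSED FAMILY 3 OF (3.105) SUMMED OVER THE COVER** (FLAT): `Σ_□ conj b((M_{h_□}·O_□·M_{h_□}·(M_{ζ_□}·(P − Pl_□)))^ℝ) ≺ 3·5^{d+1}·(B_OK_TΛc₁(δ₀, a_T − ρ))·e^{−ρδ₀d}`
from the per-cube located-difference majorants `hXT □` (uniform `K_T`, rate `a_T`; sources global), the letters' blocks `hO □`, the transfer of `ℓ⁻²`, (2.61) — §2 per cube with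
the ROW indicator `𝟙[a ∈ S_□]`, `Σ_□ 𝟙[a ∈ S_□] ≤ 3·5^{d+1}` (`hcnt_SQT` read at the row), `hasMajorant_localSum`.
[cite: Balaban1985BackgroundPropagators, (3.105)–(3.106) p.414, p.415 l.18–37, (3.91) p.410, (3.87) p.409; Balaban1984PropagatorsII, (2.52)–(2.55) p.232, (2.36) p.229, p.235, Lemma 2.1 (2.60)–(2.61) p.234] -/
theorem hasMajorant_sum_famThreeT (ζ : ↥(cubes i.D.toDomains) → SiteY i → ℝ) (hζ : ∀ c z, hTY i c z ≠ 0 → ζ c z = 1)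
    [Fintype (geo9K i).Site] (ιB : BlkY i → IBondY i) (hι : ∀ s, β i.hN i.D i.hk (ιB s) = s) (Rr : ℝ) (Hp : Prop)
    (P : (FBondY i → 𝔸) →ₗ[ℂ] (FBondY i → 𝔸)) (Pl O : ↥(cubes i.D.toDomains) → (FBondY i → 𝔸) →ₗ[ℂ] (FBondY i → 𝔸)) (dB : ℕ)
    {δ₀ aT bO αst ρ KT BO Λ : ℝ}
    (hδ₀ : 0 ≤ δ₀) (hKT : 0 ≤ KT) (hBO : 0 ≤ BO) (hΛ : 0 ≤ Λ) (hρ : 0 ≤ ρ) (hsplit : αst + ρ ≤ bO)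
    (h261 : Ineq261 dB (toB6 (geo9K i) Rr Hp) δ₀ (aT - ρ)) (hST : ScaleTransfer (geo9K i) δ₀ αst Λ (fun a => ((geo9K i).len a ^ 2)⁻¹))
    (hXT : ∀ c : ↥(cubes i.D.toDomains), HasMajorant (g := toB6 (geo9K i) Rr Hp) (fun p : FBondY i × ι => ιB (blkV1 i.hN i.D p.1))
      (conj b ((cutMulY (𝔸 := 𝔸) (hBdY i (hTY i c)) * (P - Pl c)).restrictScalars ℝ))
      (fun a y => KT * ((geo9K i).len a ^ 2)⁻¹ * Real.exp (-(aT * δ₀ * (geo9K i).dist a y))))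
    (hO : ∀ c : ↥(cubes i.D.toDomains), HasMajorant (g := toB6 (geo9K i) Rr Hp) (fun p : FBondY i × ι => ιB (blkV1 i.hN i.D p.1))
      (conj b ((O c).restrictScalars ℝ)) (fun y b' => BO * (geo9K i).len y ^ 2 * Real.exp (-(bO * δ₀ * (geo9K i).dist y b')))) :
    HasMajorant (g := toB6 (geo9K i) Rr Hp) (fun p : FBondY i × ι => ιB (blkV1 i.hN i.D p.1))
      (∑ c : ↥(cubes i.D.toDomains), conj b ((cutMulY (𝔸 := 𝔸) (hBdY i (hTY i c)) * O c * cutMulY (𝔸 := 𝔸) (hBdY i (hTY i c)) *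
        (cutMulY (𝔸 := 𝔸) (hBdY i (ζ c)) * (P - Pl c))).restrictScalars ℝ))
      (fun a b' => (3 * 5 ^ (d + 1)) *
        ((BO * KT * Λ * B6.c1 dB δ₀ (aT - ρ)) * Real.exp (-(ρ * δ₀ * (geo9K i).dist a b')))) := by
  have hκ : 0 ≤ BO * KT * Λ * B6.c1 dB δ₀ (aT - ρ) := mul_nonneg (mul_nonneg (mul_nonneg hBO hKT) hΛ) (c1_nonneg _ _ _)
  exact hasMajorant_localSum (G := toB6 (geo9K i) Rr Hp) (fun p : FBondY i × ι => ιB (blkV1 i.hN i.D p.1))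
    (fun c => conj b ((cutMulY (𝔸 := 𝔸) (hBdY i (hTY i c)) * O c * cutMulY (𝔸 := 𝔸) (hBdY i (hTY i c)) *
      (cutMulY (𝔸 := 𝔸) (hBdY i (ζ c)) * (P - Pl c))).restrictScalars ℝ))
    (fun c a => if a ∈ SQT i c then (1 : ℝ) else 0)
    (fun a b' => (BO * KT * Λ * B6.c1 dB δ₀ (aT - ρ)) * Real.exp (-(ρ * δ₀ * (geo9K i).dist a b')))
    (3 * 5 ^ (d + 1)) (fun a b' => mul_nonneg hκ (Real.exp_nonneg _))
    (fun c => hasMajorant_famThreeT_core i c b (ζ c) (hζ c) ιB hι Rr Hp (O c) P (Pl c) dB hδ₀ hKT hBO hΛ hρ hsplit h261 hST (hXT c) (hO c))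
    (hcnt_SQT i)

/-! ## §4  The letters' blocks read off their `EBlock`s (the consumer's `hEO`); the ζ of record; the `ℓ(a)ℓ(a′)⁻¹` currency -/

variable {B : B9.Backgrounds} (cfg : B.Cfg → CfgY 𝔸 i) {U₁ : B.Cfg}

open Classical in
set_option maxHeartbeats 1600000 in
/-- ★★★ **THE CONSUMER's TRANSPOSED FAMILY-3 SUMMAND OF `hV′`, FLAT, MODULO THE PER-CUBE LOCATED-DIFFERENCE MAJORANT**: with `hEO : ∀ □, EBlock (kernelFamilyBInv i B cfg (Oc □) par) B₀ δ U₁`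
(the (3.42) blocks of the cut letters), ANY family `ζ_□` with `ζ_□ = 1` on `supp h_□`, the member word `P` and cube words `Pl □` with `hXT □ : conj b((M_{h_□}·(P − Pl □))^ℝ) ≺
K_T·ℓ(a)⁻²·e^{−a_Tδ·d}`, (2.61) at `(δ, a_T − ρ)`, the transfer of `ℓ⁻²` at `(δ, α_st)`, `α_st + ρ ≤ 1`:
`Σ_□ conj b((M_{h_□}·Oc □ (cfg U₁)·M_{h_□}·(M_{ζ_□}·(P − Pl □)))^ℝ) ≺ 3·5^{d+1}·((M₂Σ‖b_j‖B₀)K_TΛc₁(δ, a_T − ρ))·e^{−ρδ·d(a,b′)}`.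
[cite: Balaban1985BackgroundPropagators, (3.105)–(3.106) p.414, p.415 l.18–37, p.412 l.22–36, Cor. 3.6 p.408, (3.87) p.409, (3.91) p.410; Balaban1984PropagatorsII, (2.51)–(2.55) p.232, Lemma 2.1 (2.60)–(2.61) p.234] -/
theorem hasMajorant_sum_famThreeT_of_eBlock (par : BondParY 𝔸 i) (Oc : ↥(cubes i.D.toDomains) → BondOpY 𝔸 i) {B₀ δ : ℝ} (hB₀ : 0 ≤ B₀) (hδ : 0 ≤ δ)
    (hEO : ∀ c : ↥(cubes i.D.toDomains), EBlock (kernelFamilyBInv i B cfg (Oc c) par) B₀ δ U₁)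
    {M₂ : ℝ} (hM₂ : 0 ≤ M₂) (hrepr : ∀ (v : 𝔸) (j : ι), |b.repr v j| ≤ M₂ * ‖v‖)
    (ζ : ↥(cubes i.D.toDomains) → SiteY i → ℝ) (hζ : ∀ c z, hTY i c z ≠ 0 → ζ c z = 1)
    [Fintype (geo9K i).Site] (ιB : BlkY i → IBondY i) (hι : ∀ s, β i.hN i.D i.hk (ιB s) = s) (Rr : ℝ) (Hp : Prop)
    (P : (FBondY i → 𝔸) →ₗ[ℂ] (FBondY i → 𝔸)) (Pl : ↥(cubes i.D.toDomains) → (FBondY i → 𝔸) →ₗ[ℂ] (FBondY i → 𝔸)) (dB : ℕ) {aT αst ρ KT Λ : ℝ}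
    (hKT : 0 ≤ KT) (hΛ : 0 ≤ Λ) (hρ : 0 ≤ ρ) (hsplit : αst + ρ ≤ 1)
    (h261 : Ineq261 dB (toB6 (geo9K i) Rr Hp) δ (aT - ρ)) (hST : ScaleTransfer (geo9K i) δ αst Λ (fun a => ((geo9K i).len a ^ 2)⁻¹))
    (hXT : ∀ c : ↥(cubes i.D.toDomains), HasMajorant (g := toB6 (geo9K i) Rr Hp) (fun p : FBondY i × ι => ιB (blkV1 i.hN i.D p.1))
      (conj b ((cutMulY (𝔸 := 𝔸) (hBdY i (hTY i c)) * (P - Pl c)).restrictScalars ℝ))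
      (fun a y => KT * ((geo9K i).len a ^ 2)⁻¹ * Real.exp (-(aT * δ * (geo9K i).dist a y)))) :
    HasMajorant (g := toB6 (geo9K i) Rr Hp) (fun p : FBondY i × ι => ιB (blkV1 i.hN i.D p.1))
      (∑ c : ↥(cubes i.D.toDomains), conj b ((cutMulY (𝔸 := 𝔸) (hBdY i (hTY i c)) * Oc c (cfg U₁) * cutMulY (𝔸 := 𝔸) (hBdY i (hTY i c)) *
        (cutMulY (𝔸 := 𝔸) (hBdY i (ζ c)) * (P - Pl c))).restrictScalars ℝ))
      (fun a b' => (3 * 5 ^ (d + 1)) *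
        (((M₂ * (∑ j, ‖b j‖) * B₀) * KT * Λ * B6.c1 dB δ (aT - ρ)) * Real.exp (-(ρ * δ * (geo9K i).dist a b')))) := by
  have hSb : 0 ≤ ∑ j, ‖b j‖ := Finset.sum_nonneg fun _ _ => norm_nonneg _
  have hBO : 0 ≤ M₂ * (∑ j, ‖b j‖) * B₀ := mul_nonneg (mul_nonneg hM₂ hSb) hB₀
  have hO : ∀ c : ↥(cubes i.D.toDomains), HasMajorant (g := toB6 (geo9K i) Rr Hp) (fun p : FBondY i × ι => ιB (blkV1 i.hN i.D p.1))
      (conj b ((Oc c (cfg U₁)).restrictScalars ℝ))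
      (fun y b' => (M₂ * (∑ j, ‖b j‖) * B₀) * (geo9K i).len y ^ 2 * Real.exp (-(1 * δ * (geo9K i).dist y b'))) := fun c =>
    hasMajorant_mono (g := toB6 (geo9K i) Rr Hp) _
      (hasMajorant_conj_G_of_eBlockInvB i b cfg (Oc c) par (Rr := Rr) (Hp := Hp) (hEO c) hB₀ ιB hι hM₂ hrepr ((Oc c (cfg U₁)).restrictScalars ℝ) (fun _ => rfl))
      fun a a' => by rw [one_mul]
  exact hasMajorant_sum_famThreeT i b ζ hζ ιB hι Rr Hp P Pl (fun c => Oc c (cfg U₁)) dB (bO := 1) hδ hKT hBO hΛ hρ hsplit h261 hST hXT hO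

open Classical in
set_option maxHeartbeats 1600000 in
/-- ★★ **AT THE ζ OF RECORD AND THE CONSUMER's `P`**: `hasMajorant_sum_famThreeT_of_eBlock` with `ζ_□ := zetaY i □` (`hζ` DISCHARGED: `zetaY_eq_one_of_hTY_ne_zero`) and
`P := DPDsY i parS G′ (cfg U₁)` — the `hV′` transposed family-3 summand of `eBlock_kernelFamilyBInv_GAY_of_localInverseCubes''` VERBATIM (flat kernel), modulo `hXT`
(supplier F3-D1 ∘ F3-B at the swapped pair ∘ F3-B3), `hEO`, the member (2.61), the transfer of `ℓ⁻²`.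
[cite: Balaban1985BackgroundPropagators, (3.105)–(3.106) p.414 («ζ_□̃ … = 1 on a cube containing □»), p.415 l.18–37, Cor. 3.6 p.408, (3.87) p.409, (3.91) p.410; Balaban1984PropagatorsII, (2.51)–(2.55) p.232, Lemma 2.1 (2.60)–(2.61) p.234] -/
theorem hasMajorant_sum_famThreeT_zetaY_of_eBlock (par : BondParY 𝔸 i) (parS : SiteParY 𝔸 i) (Gp : SiteOpY 𝔸 i)
    (Oc : ↥(cubes i.D.toDomains) → BondOpY 𝔸 i) {B₀ δ : ℝ} (hB₀ : 0 ≤ B₀) (hδ : 0 ≤ δ)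
    (hEO : ∀ c : ↥(cubes i.D.toDomains), EBlock (kernelFamilyBInv i B cfg (Oc c) par) B₀ δ U₁)
    {M₂ : ℝ} (hM₂ : 0 ≤ M₂) (hrepr : ∀ (v : 𝔸) (j : ι), |b.repr v j| ≤ M₂ * ‖v‖)
    [Fintype (geo9K i).Site] (ιB : BlkY i → IBondY i) (hι : ∀ s, β i.hN i.D i.hk (ιB s) = s) (Rr : ℝ) (Hp : Prop)
    (Pl : ↥(cubes i.D.toDomains) → (FBondY i → 𝔸) →ₗ[ℂ] (FBondY i → 𝔸)) (dB : ℕ) {aT αst ρ KT Λ : ℝ}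
    (hKT : 0 ≤ KT) (hΛ : 0 ≤ Λ) (hρ : 0 ≤ ρ) (hsplit : αst + ρ ≤ 1)
    (h261 : Ineq261 dB (toB6 (geo9K i) Rr Hp) δ (aT - ρ)) (hST : ScaleTransfer (geo9K i) δ αst Λ (fun a => ((geo9K i).len a ^ 2)⁻¹))
    (hXT : ∀ c : ↥(cubes i.D.toDomains), HasMajorant (g := toB6 (geo9K i) Rr Hp) (fun p : FBondY i × ι => ιB (blkV1 i.hN i.D p.1))
      (conj b ((cutMulY (𝔸 := 𝔸) (hBdY i (hTY i c)) * (DPDsY i parS Gp (cfg U₁) - Pl c)).restrictScalars ℝ))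
      (fun a y => KT * ((geo9K i).len a ^ 2)⁻¹ * Real.exp (-(aT * δ * (geo9K i).dist a y)))) :
    HasMajorant (g := toB6 (geo9K i) Rr Hp) (fun p : FBondY i × ι => ιB (blkV1 i.hN i.D p.1))
      (∑ c : ↥(cubes i.D.toDomains), conj b ((cutMulY (𝔸 := 𝔸) (hBdY i (hTY i c)) * Oc c (cfg U₁) * cutMulY (𝔸 := 𝔸) (hBdY i (hTY i c)) *
        (cutMulY (𝔸 := 𝔸) (hBdY i (zetaY i c)) * (DPDsY i parS Gp (cfg U₁) - Pl c))).restrictScalars ℝ))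
      (fun a b' => (3 * 5 ^ (d + 1)) *
        (((M₂ * (∑ j, ‖b j‖) * B₀) * KT * Λ * B6.c1 dB δ (aT - ρ)) * Real.exp (-(ρ * δ * (geo9K i).dist a b')))) :=
  hasMajorant_sum_famThreeT_of_eBlock i b cfg par Oc hB₀ hδ hEO hM₂ hrepr (fun c => zetaY i c) (fun c _ hz => zetaY_eq_one_of_hTY_ne_zero i c hz)
    ιB hι Rr Hp (DPDsY i parS Gp (cfg U₁)) Pl dB hKT hΛ hρ hsplit h261 hST hXT

omit [Fintype ι] in
/-- ★★ **THE `ℓ(a)·ℓ(a′)⁻¹` CURRENCY OF `hV′`**: a flat majorant `N·(Θ·e^{−r·d})` becomes `(N·Θ·Λ_m)·ℓ(a)·ℓ(a′)⁻¹·e^{−(1−α_m)·r·d}` under the transfer of `ℓ` at `(r, α_m)` (p33 D3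
`flat_le_src_weight`; supplier D4 `scaleTransfer_len_geo9K` above one member threshold). [cite: Balaban1985BackgroundPropagators, (3.106) p.414, p.398 remark after (3.47); Balaban1984PropagatorsII, Lemma 2.1 (2.60) p.234, (2.51) p.232] -/
theorem hasMajorant_src_of_flat [Fintype (geo9K i).Site] (Rr : ℝ) (Hp : Prop) (ιB : BlkY i → IBondY i) (T : Module.End ℝ (FBondY i × ι → ℝ))
    {N Θ r αm Λm : ℝ} (hN : 0 ≤ N) (hΘ : 0 ≤ Θ) (hSTm : ScaleTransfer (geo9K i) r αm Λm (fun a => (geo9K i).len a))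
    (hT : HasMajorant (g := toB6 (geo9K i) Rr Hp) (fun p : FBondY i × ι => ιB (blkV1 i.hN i.D p.1)) T
      (fun a b' => N * (Θ * Real.exp (-(r * (geo9K i).dist a b'))))) :
    HasMajorant (g := toB6 (geo9K i) Rr Hp) (fun p : FBondY i × ι => ιB (blkV1 i.hN i.D p.1)) T
      (fun a b' => (N * Θ * Λm) * (geo9K i).len a * ((geo9K i).len b')⁻¹ * Real.exp (-((1 - αm) * r * (geo9K i).dist a b'))) := by
  refine hasMajorant_mono (g := toB6 (geo9K i) Rr Hp) _ hT fun a b' => ?_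
  have h := flat_le_src_weight i (δ := r) (αm := αm) (Λm := Λm) (κ := N * Θ) (mul_nonneg hN hΘ) hSTm a b'
  calc N * (Θ * Real.exp (-(r * (geo9K i).dist a b'))) = N * Θ * Real.exp (-(r * (geo9K i).dist a b')) := by ring
    _ ≤ _ := h

open Classical in
set_option maxHeartbeats 1600000 in
/-- ★★ **THE CONSUMER's TRANSPOSED FAMILY-3 SUMMAND IN `hV′`'s CURRENCY**: `hasMajorant_sum_famThreeT_zetaY_of_eBlock` composed with the transfer of `ℓ` at `(ρδ, α_m)`:
`Σ_□ conj b((M_{h_□}·Oc □ (cfg U₁)·M_{h_□}·(M_{ζ_□̃}·(DPD*(U₁) − Pl □)))^ℝ) ≺ (3·5^{d+1}·((M₂Σ‖b_j‖B₀)K_TΛc₁)·Λ_m)·ℓ(a)·ℓ(a′)⁻¹·e^{−(1−α_m)ρδ·d(a,a′)}` — the shape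
`θV′·ℓ(a)·ℓ(a′)⁻¹·e^{−δ₀′d}` of `eBlock_kernelFamilyBInv_GAY_of_localInverseCubes''`'s `hV′`.
[cite: Balaban1985BackgroundPropagators, (3.106) p.414, p.415 l.18–37, p.398 remark after (3.47), Cor. 3.6 p.408; Balaban1984PropagatorsII, Lemma 2.1 (2.60)–(2.61) p.234, (2.51)–(2.55) p.232] -/
theorem hasMajorant_sum_famThreeT_zetaY_of_eBlock_src (par : BondParY 𝔸 i) (parS : SiteParY 𝔸 i) (Gp : SiteOpY 𝔸 i)
    (Oc : ↥(cubes i.D.toDomains) → BondOpY 𝔸 i) {B₀ δ : ℝ} (hB₀ : 0 ≤ B₀) (hδ : 0 ≤ δ)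
    (hEO : ∀ c : ↥(cubes i.D.toDomains), EBlock (kernelFamilyBInv i B cfg (Oc c) par) B₀ δ U₁)
    {M₂ : ℝ} (hM₂ : 0 ≤ M₂) (hrepr : ∀ (v : 𝔸) (j : ι), |b.repr v j| ≤ M₂ * ‖v‖)
    [Fintype (geo9K i).Site] (ιB : BlkY i → IBondY i) (hι : ∀ s, β i.hN i.D i.hk (ιB s) = s) (Rr : ℝ) (Hp : Prop)
    (Pl : ↥(cubes i.D.toDomains) → (FBondY i → 𝔸) →ₗ[ℂ] (FBondY i → 𝔸)) (dB : ℕ) {aT αst ρ KT Λ αm Λm : ℝ}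
    (hKT : 0 ≤ KT) (hΛ : 0 ≤ Λ) (hρ : 0 ≤ ρ) (hsplit : αst + ρ ≤ 1)
    (h261 : Ineq261 dB (toB6 (geo9K i) Rr Hp) δ (aT - ρ)) (hST : ScaleTransfer (geo9K i) δ αst Λ (fun a => ((geo9K i).len a ^ 2)⁻¹))
    (hSTm : ScaleTransfer (geo9K i) (ρ * δ) αm Λm (fun a => (geo9K i).len a))
    (hXT : ∀ c : ↥(cubes i.D.toDomains), HasMajorant (g := toB6 (geo9K i) Rr Hp) (fun p : FBondY i × ι => ιB (blkV1 i.hN i.D p.1))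
      (conj b ((cutMulY (𝔸 := 𝔸) (hBdY i (hTY i c)) * (DPDsY i parS Gp (cfg U₁) - Pl c)).restrictScalars ℝ))
      (fun a y => KT * ((geo9K i).len a ^ 2)⁻¹ * Real.exp (-(aT * δ * (geo9K i).dist a y)))) :
    HasMajorant (g := toB6 (geo9K i) Rr Hp) (fun p : FBondY i × ι => ιB (blkV1 i.hN i.D p.1))
      (∑ c : ↥(cubes i.D.toDomains), conj b ((cutMulY (𝔸 := 𝔸) (hBdY i (hTY i c)) * Oc c (cfg U₁) * cutMulY (𝔸 := 𝔸) (hBdY i (hTY i c)) *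
        (cutMulY (𝔸 := 𝔸) (hBdY i (zetaY i c)) * (DPDsY i parS Gp (cfg U₁) - Pl c))).restrictScalars ℝ))
      (fun a b' => ((3 * 5 ^ (d + 1)) * ((M₂ * (∑ j, ‖b j‖) * B₀) * KT * Λ * B6.c1 dB δ (aT - ρ)) * Λm) *
        (geo9K i).len a * ((geo9K i).len b')⁻¹ * Real.exp (-((1 - αm) * (ρ * δ) * (geo9K i).dist a b'))) := by
  have hSb : 0 ≤ ∑ j, ‖b j‖ := Finset.sum_nonneg fun _ _ => norm_nonneg _
  have hΘ : 0 ≤ (M₂ * (∑ j, ‖b j‖) * B₀) * KT * Λ * B6.c1 dB δ (aT - ρ) :=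
    mul_nonneg (mul_nonneg (mul_nonneg (mul_nonneg (mul_nonneg hM₂ hSb) hB₀) hKT) hΛ) (c1_nonneg _ _ _)
  exact hasMajorant_src_of_flat i Rr Hp ιB _ (by positivity) hΘ hSTm
    (hasMajorant_sum_famThreeT_zetaY_of_eBlock i b cfg par parS Gp Oc hB₀ hδ hEO hM₂ hrepr ιB hι Rr Hp Pl dB hKT hΛ hρ hsplit h261 hST hXT)

/-! ## §5  One theorem for the assembler: the `hV′` summand from the NEAR binders `hXn □` (F3-B at the swapped pair), `hP`, the cube data `hPlC □` -/

open B9CubeLettersBondOpsL0 (BlkCubeY)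
open B9CubeGeometryInputs (geoCK)
open B9Thm39CinvAtCover (DsepT)
open B9Eq3105AtLetters (DPDsCubeY)
open B9Cor35GCubeInputsAtOne (blkBK)
open B9Cor36GCubeLocLetter (locProjBY)
open B9Eq3105FamThreeTFar (hasMajorant_famThreeT_located)
open Node00 (GaugeY)

open Classical in
set_option maxHeartbeats 3200000 in
/-- ★★★ **THE CONSUMER's TRANSPOSED FAMILY-3 SUMMAND OF `hV′` FROM THE NEAR BINDERS** (F3-D1 §4 inside §4's cover theorem): at the ζ of record, `P := DPD*(U₁)`,
`Pl □ := locProjBY □ parS (u □) Ṽ_□` (G-F2's transported cube projection), from — per cube — the both-sides-located word at the swapped pair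
`hXn □ : conj b((M_{h_□}·(P − Pl □)·M_{ζ_□̃})^ℝ) ≺ K_n·ℓ(a)⁻²·e^{−a_nδd}` (p33's F3-B Member §5 at `(hTY i □, zetaY i □)`), the cube-side (3.49)₄ datum `hPlC □` of
`DP_□D*(Ṽ_□)` (D2a), the cube (2.61) at `α ≤ 1`; — once — the member word's majorant `hP` (Z2-P §2), the cut letters' blocks `hEO`, the member (2.61) at `(δ, ρ₁ − ρ)`, the
transfer of `ℓ⁻²` at `(δ, α_st)`; and the budgets `ρ₁ ≤ a_n`, `a_sep + ρ₁ ≤ a_P`, `a_sep·δ + ρ₁·δ ≤ (1−α)·δ_P`, `α_st + ρ ≤ 1`: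
`Σ_□ conj b((M_{h_□}·Oc □ (cfg U₁)·M_{h_□}·(M_{ζ_□̃}·(DPD*(U₁) − Pl □)))^ℝ) ≺ 3·5^{d+1}·((M₂Σ‖b_j‖B₀)·K_T·Λ·c₁(δ, ρ₁ − ρ))·e^{−ρδ·d}`,
`K_T = K_n + (K_P + (M₂Σ‖b_j‖)²K_Cc₁(δ_P,α))·e^{−a_sep·δ·D_sep}` — the state of the transposed family 3 read off `hXn` alone (D1 ∕ hT3 inside it).
[cite: Balaban1985BackgroundPropagators, (3.105)–(3.106) p.414, p.415 l.18–37, p.412 l.22–36, (3.49) p.399, (3.25) p.394, Cor. 3.6 p.408, p.409 l.1–5, (3.87) p.409, (3.91) p.410; Balaban1984PropagatorsII, (2.83)–(2.85) pp.237–238, (2.51)–(2.55) p.232, Lemma 2.1 (2.60)–(2.61) p.234] -/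
theorem hasMajorant_sum_famThreeT_zetaY_of_near (par : BondParY 𝔸 i) (parS : SiteParY 𝔸 i) (Gp : SiteOpY 𝔸 i)
    (Oc : ↥(cubes i.D.toDomains) → BondOpY 𝔸 i) {B₀ δ : ℝ} (hB₀ : 0 ≤ B₀) (hδ : 0 ≤ δ)
    (hEO : ∀ c : ↥(cubes i.D.toDomains), EBlock (kernelFamilyBInv i B cfg (Oc c) par) B₀ δ U₁)
    {M₂ : ℝ} (hM₂ : 0 ≤ M₂) (hrepr : ∀ (v : 𝔸) (j : ι), |b.repr v j| ≤ M₂ * ‖v‖)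
    (u : ↥(cubes i.D.toDomains) → GaugeY 𝔸 i) (hu : ∀ c x, ‖((u c x : 𝔸ˣ) : 𝔸)‖ ≤ 1 ∧ ‖(((u c x)⁻¹ : 𝔸ˣ) : 𝔸)‖ ≤ 1)
    (V : ↥(cubes i.D.toDomains) → CfgY 𝔸 i)
    [Fintype (geo9K i).Site] (ιB : BlkY i → IBondY i) (hι : ∀ s, β i.hN i.D i.hk (ιB s) = s) (Rr : ℝ) (H : Prop) (Rr' : ℝ) (Hp : Prop)
    (dB dC : ℕ) {an aP asep ρ₁ ρ Kn KP KC δP α αst Λ : ℝ}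
    (hKn : 0 ≤ Kn) (hKP : 0 ≤ KP) (hKC : 0 ≤ KC) (hδP : 0 ≤ δP) (hα1 : α ≤ 1) (hasep : 0 ≤ asep) (hΛ : 0 ≤ Λ) (hρ : 0 ≤ ρ)
    (hρn : ρ₁ ≤ an) (hsplitP : asep + ρ₁ ≤ aP) (hsplitC : asep * δ + ρ₁ * δ ≤ (1 - α) * δP) (hsplit : αst + ρ ≤ 1)
    (h261C : ∀ c : ↥(cubes i.D.toDomains), Ineq261 dC (toB6 (geoCK i c) Rr H) δP α)
    (h261 : Ineq261 dB (toB6 (geo9K i) Rr' Hp) δ (ρ₁ - ρ)) (hST : ScaleTransfer (geo9K i) δ αst Λ (fun a => ((geo9K i).len a ^ 2)⁻¹))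
    (hXn : ∀ c : ↥(cubes i.D.toDomains), HasMajorant (g := toB6 (geo9K i) Rr' Hp) (fun p : FBondY i × ι => ιB (blkV1 i.hN i.D p.1))
      (conj b ((cutMulY (𝔸 := 𝔸) (hBdY i (hTY i c)) * (DPDsY i parS Gp (cfg U₁) - locProjBY i c parS (u c) (V c)) *
        cutMulY (𝔸 := 𝔸) (hBdY i (zetaY i c))).restrictScalars ℝ))
      (fun a y => Kn * ((geo9K i).len a ^ 2)⁻¹ * Real.exp (-(an * δ * (geo9K i).dist a y))))
    (hP : HasMajorant (g := toB6 (geo9K i) Rr' Hp) (fun p : FBondY i × ι => ιB (blkV1 i.hN i.D p.1))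
      (conj b ((DPDsY i parS Gp (cfg U₁)).restrictScalars ℝ))
      (fun a y => KP * ((geo9K i).len a ^ 2)⁻¹ * Real.exp (-(aP * δ * (geo9K i).dist a y))))
    (hPlC : ∀ c : ↥(cubes i.D.toDomains), HasMajorant (g := toB6 (geoCK i c) Rr H) (blkBK i c)
      (conj b ((DPDsCubeY i c parS (V c)).restrictScalars ℝ))
      (fun a s => KC * ((geoCK i c).len a ^ 2)⁻¹ * Real.exp (-(δP * (geoCK i c).dist a s)))) :
    HasMajorant (g := toB6 (geo9K i) Rr' Hp) (fun p : FBondY i × ι => ιB (blkV1 i.hN i.D p.1))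
      (∑ c : ↥(cubes i.D.toDomains), conj b ((cutMulY (𝔸 := 𝔸) (hBdY i (hTY i c)) * Oc c (cfg U₁) * cutMulY (𝔸 := 𝔸) (hBdY i (hTY i c)) *
        (cutMulY (𝔸 := 𝔸) (hBdY i (zetaY i c)) * (DPDsY i parS Gp (cfg U₁) - locProjBY i c parS (u c) (V c)))).restrictScalars ℝ))
      (fun a b' => (3 * 5 ^ (d + 1)) *
        (((M₂ * (∑ j, ‖b j‖) * B₀) * ((Kn + (KP + (M₂ * ∑ j, ‖b j‖) ^ 2 * (KC * B6.c1 dC δP α)) * Real.exp (-(asep * δ * DsepT i)))) * Λ *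
            B6.c1 dB δ (ρ₁ - ρ)) * Real.exp (-(ρ * δ * (geo9K i).dist a b')))) := by
  have hSb : 0 ≤ (M₂ * ∑ j, ‖b j‖) ^ 2 := sq_nonneg _
  have hKT : 0 ≤ Kn + (KP + (M₂ * ∑ j, ‖b j‖) ^ 2 * (KC * B6.c1 dC δP α)) * Real.exp (-(asep * δ * DsepT i)) :=
    add_nonneg hKn (mul_nonneg (add_nonneg hKP (mul_nonneg hSb (mul_nonneg hKC (c1_nonneg _ _ _)))) (Real.exp_nonneg _))
  exact hasMajorant_sum_famThreeT_zetaY_of_eBlock i b cfg par parS Gp Oc hB₀ hδ hEO hM₂ hrepr ιB hι Rr' Hp (fun c => locProjBY i c parS (u c) (V c)) dB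
    (aT := ρ₁) hKT hΛ hρ hsplit h261 hST
    fun c => hasMajorant_famThreeT_located i c b hM₂ hrepr parS (u c) (hu c) (V c) ιB hι Rr H Rr' Hp (DPDsY i parS Gp (cfg U₁)) dC
      hδ hKn hKP hKC hδP hα1 hasep hρn hsplitP hsplitC (h261C c) (hXn c) hP (hPlC c)

/-! ## §6  The same with the member word's majorant `hP` SUPPLIED by Z2-P §2 (the consumer's `hE`, `hCinv`, bi-contractive `parS`, `η = |c_f|⁻¹`) -/

open B9CubeLettersInvReadings (kernelFamilySInv)
open B9Ineq368PPrime (kappa349)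
open B9Ineq368PPrimeDs (kappa349_nonneg)
open B9Ineq349DPDsYOfEBlock (hasMajorant_conj_DPDsY_of_eBlockInv)
open Node00 (etaS XinvY)

set_option maxHeartbeats 3200000 in
/-- ★★★ **THE CONSUMER's TRANSPOSED FAMILY-3 SUMMAND OF `hV′` FROM THE NEAR BINDERS, `hP` SUPPLIED**: §5 with the member word's (3.49)₄ majorant taken from p33's
Z2-P §2 `hasMajorant_conj_DPDsY_of_eBlockInv` — i.e. modulo, per cube, the near binder `hXn □` (F3-B at the swapped pair) and D2a's cube datum `hPlC □` + the cube (2.61),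
and, once, the letters' blocks (`hE`: (3.42) for `G′(U₁)`; `hEO`: the `O_□(U₁)`), `hCinv` ((3.48)), bi-contractive `parS`, `η = |c_f|⁻¹`, the member (2.61) ∕ transfers
and the budgets (`a_sep + ρ₁ ≤ ρ_P∕δ`):
`Σ_□ conj b((M_{h_□}·O_□(U₁)·M_{h_□}·(M_{ζ_□̃}·(DPD*(U₁) − Pl □)))^ℝ) ≺ 3·5^{d+1}·((M₂Σ‖b_j‖B_O)·K_T·Λ′·c₁(δ, ρ₁ − ρ))·e^{−ρδ·d}`,
`K_T = K_n + (κ₃₄₉ + (M₂Σ‖b_j‖)²K_Cc₁(δ_P,α))·e^{−a_sep·δ·D_sep}`.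
[cite: Balaban1985BackgroundPropagators, (3.105)–(3.106) p.414, p.415 l.18–37, (3.49) p.399, (3.25) p.394, Thm 3.1 (3.42) p.397, Thm 3.2 (3.48) p.398, Cor. 3.6 p.408, p.409 l.1–5, (3.87) p.409, (3.91) p.410; Balaban1984PropagatorsII, (2.83)–(2.85) pp.237–238, (2.51)–(2.55) p.232, Lemma 2.1 (2.60)–(2.61) p.234] -/
theorem hasMajorant_sum_famThreeT_zetaY_of_near_closedP [DecidableEq (geo9K i).Site]
    (par : BondParY 𝔸 i) (parS : SiteParY 𝔸 i) (Gp : SiteOpY 𝔸 i)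
    {BG δG : ℝ} (hE : EBlock (kernelFamilySInv i B cfg Gp parS) BG δG U₁) (hBG : 0 ≤ BG)
    (Oc : ↥(cubes i.D.toDomains) → BondOpY 𝔸 i) {BO δ : ℝ} (hBO : 0 ≤ BO) (hδ : 0 < δ)
    (hEO : ∀ c : ↥(cubes i.D.toDomains), EBlock (kernelFamilyBInv i B cfg (Oc c) par) BO δ U₁)
    [Fintype (geo9K i).Site] (ιB : BlkY i → IBondY i) (hι : ∀ s, β i.hN i.D i.hk (ιB s) = s)
    (hpar : ∀ z w : SiteY i, ‖(parS (cfg U₁) z w : 𝔸)‖ ≤ 1 ∧ ‖(((parS (cfg U₁) z w)⁻¹ : 𝔸ˣ) : 𝔸)‖ ≤ 1)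
    {M₂ : ℝ} (hM₂ : 0 ≤ M₂) (hrepr : ∀ (v : 𝔸) (j : ι), |b.repr v j| ≤ M₂ * ‖v‖) (hη : etaS i = |i.cf|⁻¹)
    {s B₁ δX : ℝ} (hs : (etaS i ^ 2 * etaS i ^ 2) * s = 1) (hB₁ : 0 ≤ B₁) (Rr : ℝ) (H : Prop) (Rr' : ℝ) (Hp : Prop)
    (hCinv : HasMajorant (g := toB6 (geo9K i) Rr' Hp) (fun q : BlkY i × ι => ιB q.1) (conj b (s • (XinvY i parS Gp (cfg U₁)).restrictScalars ℝ))
      (fun a a' => B₁ * ((geo9K i).len a ^ 4)⁻¹ * Real.exp (-(δX * (geo9K i).dist a a'))))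
    (dP : ℕ) {δ₀ δP' αP β' ρP ΛP : ℝ} (hΛP : 1 ≤ ΛP) (hρP : 0 ≤ ρP) (hαP : 0 ≤ αP) (hβ : 0 ≤ β') (hδ₀ : 0 ≤ δ₀)
    (hδG' : δP' ≤ δG) (hδX' : δP' ≤ δX) (hr : ρP + (2 * αP + β') * δ₀ ≤ δP')
    (h261P : Ineq261 dP (toB6 (geo9K i) Rr' Hp) δ₀ β')
    (hT1 : ScaleTransfer (geo9K i) δ₀ αP ΛP (fun a => (geo9K i).len a)) (hT2 : ScaleTransfer (geo9K i) δ₀ αP ΛP (fun a => (geo9K i).len a ^ 2))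
    (hT4 : ScaleTransfer (geo9K i) δ₀ αP ΛP (fun a => ((geo9K i).len a ^ 4)⁻¹))
    (u : ↥(cubes i.D.toDomains) → GaugeY 𝔸 i) (hu : ∀ c x, ‖((u c x : 𝔸ˣ) : 𝔸)‖ ≤ 1 ∧ ‖(((u c x)⁻¹ : 𝔸ˣ) : 𝔸)‖ ≤ 1)
    (V : ↥(cubes i.D.toDomains) → CfgY 𝔸 i)
    (dB dC : ℕ) {an asep ρ₁ ρ Kn KC δP α αst Λ : ℝ}
    (hKn : 0 ≤ Kn) (hKC : 0 ≤ KC) (hδP : 0 ≤ δP) (hα1 : α ≤ 1) (hasep : 0 ≤ asep) (hΛ : 0 ≤ Λ) (hρ : 0 ≤ ρ)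
    (hρn : ρ₁ ≤ an) (hsplitP : asep + ρ₁ ≤ ρP / δ) (hsplitC : asep * δ + ρ₁ * δ ≤ (1 - α) * δP) (hsplit : αst + ρ ≤ 1)
    (h261C : ∀ c : ↥(cubes i.D.toDomains), Ineq261 dC (toB6 (geoCK i c) Rr H) δP α)
    (h261 : Ineq261 dB (toB6 (geo9K i) Rr' Hp) δ (ρ₁ - ρ)) (hST : ScaleTransfer (geo9K i) δ αst Λ (fun a => ((geo9K i).len a ^ 2)⁻¹))
    (hXn : ∀ c : ↥(cubes i.D.toDomains), HasMajorant (g := toB6 (geo9K i) Rr' Hp) (fun p : FBondY i × ι => ιB (blkV1 i.hN i.D p.1))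
      (conj b ((cutMulY (𝔸 := 𝔸) (hBdY i (hTY i c)) * (DPDsY i parS Gp (cfg U₁) - locProjBY i c parS (u c) (V c)) *
        cutMulY (𝔸 := 𝔸) (hBdY i (zetaY i c))).restrictScalars ℝ))
      (fun a y => Kn * ((geo9K i).len a ^ 2)⁻¹ * Real.exp (-(an * δ * (geo9K i).dist a y))))
    (hPlC : ∀ c : ↥(cubes i.D.toDomains), HasMajorant (g := toB6 (geoCK i c) Rr H) (blkBK i c)
      (conj b ((DPDsCubeY i c parS (V c)).restrictScalars ℝ))
      (fun a s' => KC * ((geoCK i c).len a ^ 2)⁻¹ * Real.exp (-(δP * (geoCK i c).dist a s')))) :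
    HasMajorant (g := toB6 (geo9K i) Rr' Hp) (fun p : FBondY i × ι => ιB (blkV1 i.hN i.D p.1))
      (∑ c : ↥(cubes i.D.toDomains), conj b ((cutMulY (𝔸 := 𝔸) (hBdY i (hTY i c)) * Oc c (cfg U₁) * cutMulY (𝔸 := 𝔸) (hBdY i (hTY i c)) *
        (cutMulY (𝔸 := 𝔸) (hBdY i (zetaY i c)) * (DPDsY i parS Gp (cfg U₁) - locProjBY i c parS (u c) (V c)))).restrictScalars ℝ))
      (fun a b' => (3 * 5 ^ (d + 1)) *
        (((M₂ * (∑ j, ‖b j‖) * BO) *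
            ((Kn + (kappa349 (M₂ * ∑ j, ‖b j‖) (((d : ℝ) + 1) * (M₂ * (∑ j, ‖b j‖) * BG)) B₁ ΛP (B6.c1 dP δ₀ β') +
              (M₂ * ∑ j, ‖b j‖) ^ 2 * (KC * B6.c1 dC δP α)) * Real.exp (-(asep * δ * DsepT i)))) * Λ * B6.c1 dB δ (ρ₁ - ρ)) *
          Real.exp (-(ρ * δ * (geo9K i).dist a b')))) := by
  have hKP : 0 ≤ kappa349 (M₂ * ∑ j, ‖b j‖) (((d : ℝ) + 1) * (M₂ * (∑ j, ‖b j‖) * BG)) B₁ ΛP (B6.c1 dP δ₀ β') := kappa349_nonneg hB₁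
  have hP := hasMajorant_conj_DPDsY_of_eBlockInv i b cfg Gp parS (Rr := Rr') (Hp := Hp) hE hBG ιB hι hpar hM₂ hrepr hη hs hB₁ hCinv dP hΛP hρP hαP hβ
    hδ₀ hδG' hδX' hr h261P hT1 hT2 hT4
  have hP' : HasMajorant (g := toB6 (geo9K i) Rr' Hp) (fun p : FBondY i × ι => ιB (blkV1 i.hN i.D p.1))
      (conj b ((DPDsY i parS Gp (cfg U₁)).restrictScalars ℝ))
      (fun a y => kappa349 (M₂ * ∑ j, ‖b j‖) (((d : ℝ) + 1) * (M₂ * (∑ j, ‖b j‖) * BG)) B₁ ΛP (B6.c1 dP δ₀ β') *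
        ((geo9K i).len a ^ 2)⁻¹ * Real.exp (-(ρP / δ * δ * (geo9K i).dist a y))) :=
    hasMajorant_mono (g := toB6 (geo9K i) Rr' Hp) _ hP fun a y => le_of_eq (by rw [div_mul_cancel₀ _ hδ.ne'])
  exact hasMajorant_sum_famThreeT_zetaY_of_near i b cfg par parS Gp Oc hBO hδ.le hEO hM₂ hrepr u hu V ιB hι Rr H Rr' Hp dB dC
    hKn hKP hKC hδP hα1 hasep hΛ hρ hρn hsplitP hsplitC hsplit h261C h261 hST hXn hP' hPlC

end Literature.MathematicalPhysics.QuantumFieldTheory.Balaban1983to89.B9Eq3105FamThreeTCover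

end
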